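import Summits.QuantumFields.YangMills.Theorems.AlphaInputsT3ACv3EMLIterFirstOrderUniform
import Summits.QuantumFields.YangMills.Theorems.AlphaInputsT3ACv3LinearLiftMatrixCLM
import Summits.QuantumFields.YangMills.Theorems.AlphaInputsT3ACv3FLPlaqUpdate
import HarnessLib

/-!
# `AlphaInputsT3ACv3SmoothLiftCandidate` — non-abelian (FL), the START on one stencil in its own frame (Newton row R9′ ∕ the zeroth iterate of (N)): **FOR SMALL COARSE LOGARITHMIC DATA
# `A : bonds(T^{(k)}) → 𝔰𝔲(n)`, `‖A‖ ≤ M`, THE FINEST FIELD `U_b := exp(liftSM k A (b))` HAS (i) bond variables within `2C_S·M/L^k` of `1`, (ii) EVERY finest plaquette within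
# `(4·18^d + 16·C_S²·M)·M/(L^k)²` of `1` — DILUTE curvature, `B` ABSOLUTE —, and (iii) `k`-fold (0.4) averages `Ū^{(k)}(c) = 1 + A(c) + O(M²)` with a `k`-FREE constant** — cell `ym3-torus`,
# width seat `ym-ust-19936-w2` (g2); composed BY NAME from ★w1's R1 (`…EMLIterFirstOrderUniform`), ★w3's (V) (`…LinearLiftMatrixCLM`), ★w4's (P) (`…PerturbedPlaquette` via `…FLPlaqUpdate`)
# and this seat's (LL+) (`liftS`)

WHY (OWNER RULING g24-№4; w1 `NONABELIAN-FL-NEWTON-w1-g0.md` R9′ «stencil candidates `exp(S1M A^{(y)})` … glued»; w4 `NEWTON-FL-FRAMES` §3–§4 «a DILUTE-curvature candidate with first-order defect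
is what (N) absorbs with B absolute»).  In the axial frame `h_y` of a stencil the datum is `V^{h_y} = exp(A)` with `A = O(ε)` small but NOT smooth; the candidate must spread it to the
finest lattice with plaquettes `O(ε·L^{−2k})` while reproducing the coarse averages to first order.  THIS FILE is that statement for the sup-small exact lift, with every constant
`k`-free: (i)∕(ii) are kinematics of `liftS` (sup `C_S/L^k`, curl `4·18^d/(L^k)²`) read through the flat plaquette ledger; (iii) is [B7] Prop. 4 at the flat background (R1) — its natural
smallness parameter `m_k = 2|n|²(d+1)L^k·δ` is `k`-FREE here BECAUSE the lift is `L^{−k}`-small in sup (`δ ≤ 2C_S M/L^k` ⇒ `m_k ≤ 4|n|²(d+1)C_S·M`), plus the exactness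
`linAvgIterM k (liftSM k A) = A` and the second order of `exp`.  Gauge invariance of plaquettes and `iter_gaugeAct_blockConst` (w1 R6-core) carry (ii)∕(iii) from the stencil frame to the
original one; gluing across stencils is R9′ proper (w4's `…GlueLedger`, this seat's `…LinearLiftCutoff`).
WHAT.  `cand k A hA : GaugeField P 0 SU(n)` (one def: `b ↦ expSU (liftSM k A b)`), `coe_cand`; §1 `norm_liftSM_le_CS` (`‖liftSM k A b‖ ≤ C_S·M/L^k ≤ C_S·M`), `norm_exp_sub_one_le_two_mul`,
`norm_coe_cand_sub_one_le` ((i)); §2 `plaqHol_one`, ★★ `dist1_plaqHol_cand_le` ((ii)); §3 ★★ `norm_iter_cand_sub_one_sub_le` ((iii): `‖Ū^{(k)}(c) − 1 − A c‖ ≤ K₁·M²`,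
`K₁ = 324L(d+2)²(4|n|²(d+1)C_S)² + (d+1)C_S²`), `norm_iter_cand_sub_one_le` (`≤ 8|n|²(d+1)C_S·M`); §4 ★★★ `exists_smoothLiftCandidate`.  Hypotheses: `k ≤ m+K`, `d+2 ≤ L` (R1's device; the
AllL twin removes it), `4·C_S·M ≤ 1`, R1's two guards in `k`-free form (`324L(d+2)²·m ≤ 1`, `4ℓ·m < δ_SU`, `m = 4|n|²(d+1)C_S·M`, `ℓ = (d+2)L`).
HONEST FRAMING.  A composition of landed kernel lemmas; count-neutral helper toward R3 2′ (items 19936∕19935, `--supports stmt-QuantumFields-19936`); `hLift`∕(FL), the stub, the crux and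
the gap are NOT claimed; registry untouched; YM₃ on T³ is rung R3, not the Clay problem.

References: T. Bałaban, Commun. Math. Phys. 98 (1985) 17–51 [Balaban1985Averaging] ((9) p.18, (19) p.21, Prop. 4 (130)–(135) p.38); Commun. Math. Phys. 109 (1987) 249–301
[Balaban1987RG1] ((0.4)+(0.11) p.253); Commun. Math. Phys. 102 (1985) 277–309 [Balaban1985Variational] (Thm 1 (8) p.279 — the `L^{−2k}` window).
-/

set_option autoImplicit false

noncomputable section

open scoped Matrix.Norms.L2Operator
open NormedSpace

namespace Summit.QuantumFields.YangMills.Theorems.SmoothLiftCandidate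

open Literature.MathematicalPhysics.QuantumFieldTheory.Balaban1983to89
open T4Continuum AveragingRT BlockAveraging ExpMeanLog BlockAveragingEMLLinearised
open Literature.MathematicalPhysics.QuantumFieldTheory.Balaban1983to89.T4AdjointCovarianceUnitary (lieSU expSU coe_expSU mem_lieSU_iff)
open Literature.Analysis.Calculus.ExpDifferential (norm_exp_sub_one_le_exp_norm_sub_one)
open Literature.MathematicalPhysics.QuantumFieldTheory.OneLinkLaplace (norm_exp_sub_one_sub_le_sq)
open Summit.QuantumFields.YangMills.Theorems.LinearLiftMatrix (liftSM liftSM_mem norm_liftSM_le linAvgIterM linAvgIterM_zero linAvgIterM_succ linAvgIterM_liftSM curlM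
  norm_curlM_liftSM_le_local norm_curlM_le_four_mul_norm CS CS_nonneg avgCLM avgCLM_apply norm_avgCLM_le)
open Summit.QuantumFields.YangMills.Theorems.EMLIterUniform (norm_iter_sub_one_sub_iterLin_le_uniform)
open Summit.QuantumFields.YangMills.Theorems.FLPlaqUpdate (dist1_plaqHol_expUpdate_le')

variable {P : Params} {n : Type*} [Fintype n] [DecidableEq n] [Nonempty n]

/-- **THE STENCIL CANDIDATE**: `U_b := exp(liftSM k A (b)) ∈ SU(n)` for `𝔰𝔲(n)`-valued coarse data `A` (the sup-small exact lift is `𝔰𝔲(n)`-valued bond by bond, `liftSM_mem`).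
[cite: Balaban1985Variational, Thm 1 (8) p.279] -/
def cand (k : ℕ) (A : PBond P k → Matrix n n ℂ) (hA : ∀ c, A c ∈ lieSU n) : GaugeField P 0 (Matrix.specialUnitaryGroup n ℂ) :=
  fun b => expSU ⟨liftSM k A b, liftSM_mem k (lieSU n) hA b⟩

variable (k : ℕ) (hk : k ≤ P.m + P.K)

omit [Nonempty n] in
/-- The candidate's matrices: `U_b = exp(liftSM k A (b))`. [cite: Balaban1985Variational, Thm 1 (8) p.279] -/
theorem coe_cand (A : PBond P k → Matrix n n ℂ) (hA : ∀ c, A c ∈ lieSU n) (b : PBond P 0) :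
    ((cand k A hA b : Matrix.specialUnitaryGroup n ℂ) : Matrix n n ℂ) = exp (liftSM k A b) := rfl

/-! ## §1 Sup sizes -/

include hk in
omit [Nonempty n] in
/-- `‖liftSM k A b‖ ≤ C_S·M/L^k ≤ C_S·M` (w3's port of `abs_liftS_le`; `L^k ≥ 1`). [cite: Balaban1987RG1, (0.4)+(0.11) p.253] -/
theorem norm_liftSM_le_CS (A : PBond P k → Matrix n n ℂ) {M : ℝ} (hM : ∀ c, ‖A c‖ ≤ M) (b : PBond P 0) :
    ‖liftSM k A b‖ ≤ CS P * M / (P.L : ℝ) ^ k ∧ ‖liftSM k A b‖ ≤ CS P * M := by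
  have h := norm_liftSM_le k hk A hM b
  have hM0 : 0 ≤ M := (norm_nonneg _).trans (hM ⟨fun _ => 0, b.dir⟩)
  have hL1 : (1 : ℝ) ≤ (P.L : ℝ) ^ k := one_le_pow₀ (by exact_mod_cast P.hL.2.le)
  have hLk : (0 : ℝ) < (P.L : ℝ) ^ k := by positivity
  have e : CS P / (P.L : ℝ) ^ k * M = CS P * M / (P.L : ℝ) ^ k := by ring
  rw [e] at h
  refine ⟨h, h.trans ?_⟩
  rw [div_le_iff₀ hLk]
  have : 0 ≤ CS P * M := mul_nonneg (CS_nonneg P) hM0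
  nlinarith

omit [Nonempty n] [DecidableEq n] [Fintype n] in
/-- `‖e^{X} − 1‖ ≤ 2t` and `‖e^{X} − 1 − X‖ ≤ t²` for `‖X‖ ≤ t ≤ 1` (in any complete normed algebra; here `M_n(ℂ)`). [folklore] -/
theorem norm_exp_sub_one_le_two_mul {𝔸 : Type*} [NormedRing 𝔸] [NormedAlgebra ℝ 𝔸] [NormOneClass 𝔸] [CompleteSpace 𝔸] (X : 𝔸) {t : ℝ} (hX : ‖X‖ ≤ t) (ht : t ≤ 1) :
    ‖exp X - 1‖ ≤ 2 * t ∧ ‖exp X - 1 - X‖ ≤ t ^ 2 := by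
  have h0 : 0 ≤ ‖X‖ := norm_nonneg _
  have hX1 : ‖X‖ ≤ 1 := hX.trans ht
  have h2 : ‖exp X - 1 - X‖ ≤ ‖X‖ ^ 2 := norm_exp_sub_one_sub_le_sq hX1
  have h2' : ‖exp X - 1 - X‖ ≤ t ^ 2 := h2.trans (by nlinarith)
  refine ⟨?_, h2'⟩
  have e : exp X - 1 = (exp X - 1 - X) + X := by abel
  rw [e]
  calc ‖exp X - 1 - X + X‖ ≤ ‖exp X - 1 - X‖ + ‖X‖ := norm_add_le _ _
    _ ≤ t ^ 2 + t := add_le_add h2' hX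
    _ ≤ 2 * t := by nlinarith

include hk in
/-- **(i) THE CANDIDATE'S BOND VARIABLES ARE `L^{−k}`-CLOSE TO `1`**: `‖U_b − 1‖ ≤ 2·C_S·M/L^k` (when `C_S·M ≤ 1`). [cite: Balaban1985Variational, Thm 1 (8) p.279] -/
theorem norm_coe_cand_sub_one_le (A : PBond P k → Matrix n n ℂ) (hA : ∀ c, A c ∈ lieSU n) {M : ℝ} (hM : ∀ c, ‖A c‖ ≤ M) (hM1 : CS P * M ≤ 1) (b : PBond P 0) :
    ‖((cand k A hA b : Matrix.specialUnitaryGroup n ℂ) : Matrix n n ℂ) - 1‖ ≤ 2 * (CS P * M / (P.L : ℝ) ^ k) ∧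
      ‖((cand k A hA b : Matrix.specialUnitaryGroup n ℂ) : Matrix n n ℂ) - 1 - liftSM k A b‖ ≤ (CS P * M / (P.L : ℝ) ^ k) ^ 2 := by
  obtain ⟨h1, h2⟩ := norm_liftSM_le_CS k hk A hM b
  have ht : CS P * M / (P.L : ℝ) ^ k ≤ 1 := by
    have hL1 : (1 : ℝ) ≤ (P.L : ℝ) ^ k := one_le_pow₀ (by exact_mod_cast P.hL.2.le)
    have hM0 : 0 ≤ CS P * M := le_trans (norm_nonneg _) h2
    exact (div_le_self hM0 hL1).trans hM1
  rw [coe_cand]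
  exact norm_exp_sub_one_le_two_mul (liftSM k A b) h1 ht

/-! ## §2 Plaquettes: dilute curvature -/

omit [DecidableEq n] [Fintype n] [Nonempty n] in
/-- The trivial configuration has trivial plaquettes. [cite: Balaban1985Averaging, (9) p.18] -/
theorem plaqHol_one {G : Type*} [GaugeGroup G] {j : ℕ} (q : Plaq P j) : GaugeField.plaqHol (1 : GaugeField P j G) q = 1 := by
  simp [GaugeField.plaqHol, show ∀ b : PBond P j, (1 : GaugeField P j G) b = 1 from fun _ => rfl]

include hk in
/-- **★★ (ii) DILUTE CURVATURE**: every finest plaquette of the candidate is within `(4·18^d·M + 16·(C_S·M)²)/(L^k)²` of `1` — the flat curl of the sup-small lift (`4·18^d·M/(L^k)²`, from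
`‖curl A‖ ≤ 4‖A‖` spread by `S²`) plus the second order of four exponentials (`16α²`, `α = C_S M/L^k`); needs `4·C_S·M ≤ 1`.  `B` is ABSOLUTE (no `k`, `L`-power only through nothing,
no volume). [cite: Balaban1985Variational, Thm 1 (8) p.279; Balaban1985Averaging, (9) p.18] -/
theorem dist1_plaqHol_cand_le (A : PBond P k → Matrix n n ℂ) (hA : ∀ c, A c ∈ lieSU n) {M : ℝ} (hM : ∀ c, ‖A c‖ ≤ M) (hM4 : 4 * (CS P * M) ≤ 1) (q : Plaq P 0) :
    GaugeGroup.dist1 (GaugeField.plaqHol (cand k A hA) q) ≤ 4 * (18 : ℝ) ^ P.d * M / ((P.L : ℝ) ^ k) ^ 2 + 16 * (CS P * M / (P.L : ℝ) ^ k) ^ 2 := by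
  have hM0 : 0 ≤ M := (norm_nonneg _).trans (hM ⟨fun _ => 0, q.μ⟩)
  have hCS := CS_nonneg P
  set a : PBond P 0 → Matrix n n ℂ := liftSM k A with ha
  set α : ℝ := CS P * M / (P.L : ℝ) ^ k with hα
  have hab : ∀ b, ‖a b‖ ≤ α := fun b => (norm_liftSM_le_CS k hk A hM b).1
  have hL1 : (1 : ℝ) ≤ (P.L : ℝ) ^ k := one_le_pow₀ (by exact_mod_cast P.hL.2.le)
  have hαle : α ≤ CS P * M := div_le_self (mul_nonneg hCS hM0) hL1
  have h4α : 4 * α ≤ 1 := by linarith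
  have hstar : ∀ b, star (a b) = -a b := fun b => (mem_lieSU_iff.mp (liftSM_mem k (lieSU n) hA b)).1
  have hU' : ∀ b, ((cand k A hA b : Matrix.specialUnitaryGroup n ℂ) : Matrix n n ℂ) = exp (a b) * (((1 : GaugeField P 0 (Matrix.specialUnitaryGroup n ℂ)) b :
      Matrix.specialUnitaryGroup n ℂ) : Matrix n n ℂ) := fun b => by
    rw [coe_cand, show (1 : GaugeField P 0 (Matrix.specialUnitaryGroup n ℂ)) b = 1 from rfl, OneMemClass.coe_one, mul_one]
  have hone : ∀ b : PBond P 0, ‖(((1 : GaugeField P 0 (Matrix.specialUnitaryGroup n ℂ)) b : Matrix.specialUnitaryGroup n ℂ) : Matrix n n ℂ) - 1‖ ≤ 0 := fun b => by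
    rw [show (1 : GaugeField P 0 (Matrix.specialUnitaryGroup n ℂ)) b = 1 from rfl, OneMemClass.coe_one, sub_self, norm_zero]
  have h := dist1_plaqHol_expUpdate_le' (1 : GaugeField P 0 (Matrix.specialUnitaryGroup n ℂ)) (cand k A hA) a hstar hU' q h4α (hab _) (hab _) (hab _) (hab _)
    (hone _) (hone _) (hone _)
  rw [plaqHol_one, GaugeGroup.dist1_one] at h
  -- the flat curl of the lift
  have hApi : ‖A‖ ≤ M := (pi_norm_le_iff_of_nonneg hM0).mpr hM
  have hcurl : ‖a ⟨q.src, q.μ⟩ + a ⟨q.src.shift q.μ, q.ν⟩ - a ⟨q.src.shift q.ν, q.μ⟩ - a ⟨q.src, q.ν⟩‖ ≤ (18 : ℝ) ^ P.d * (4 * M) / ((P.L : ℝ) ^ k) ^ 2 := by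
    have hc := norm_curlM_liftSM_le_local k hk A q.src (ne_of_lt q.hμν) (ε := 4 * M) fun y _ =>
      (norm_curlM_le_four_mul_norm A y q.μ q.ν).trans (by linarith)
    exact hc
  calc GaugeGroup.dist1 (GaugeField.plaqHol (cand k A hA) q)
      ≤ (1 + 2 * α) * 0 + ‖a ⟨q.src, q.μ⟩ + a ⟨q.src.shift q.μ, q.ν⟩ - a ⟨q.src.shift q.ν, q.μ⟩ - a ⟨q.src, q.ν⟩‖ + 8 * α * 0 + 16 * α ^ 2 := h
    _ ≤ (18 : ℝ) ^ P.d * (4 * M) / ((P.L : ℝ) ^ k) ^ 2 + 16 * α ^ 2 := by linarith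
    _ = 4 * (18 : ℝ) ^ P.d * M / ((P.L : ℝ) ^ k) ^ 2 + 16 * (CS P * M / (P.L : ℝ) ^ k) ^ 2 := by rw [hα]; ring

/-! ## §3 Averages: exact to first order, `k`-uniformly -/

include hk in
/-- **★★ (iii) THE CANDIDATE'S `k`-FOLD (0.4) AVERAGES ARE `1 + A + O(M²)` WITH A `k`-FREE CONSTANT**:
`‖Ū^{(k)}(c) − 1 − A(c)‖ ≤ (324L(d+2)²·(4|n|²(d+1)C_S)² + (d+1)·C_S²)·M²` and `‖Ū^{(k)}(c) − 1‖ ≤ 8|n|²(d+1)C_S·M` — [B7] Prop. 4 at the flat background (★w1's R1, whose parameter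
`m_k = 2|n|²(d+1)L^k·δ` is `≤ 4|n|²(d+1)C_S·M` because `δ ≤ 2C_S M/L^k`), the EXACTNESS `linAvgIterM k (liftSM k A) = A` (★w3∕this seat), and `‖Q^{(k)}(e^{a} − 1 − a)‖ ≤ (d+1)L^k·(C_S M/L^k)²`.
Guards: `d + 2 ≤ L`, `C_S·M ≤ 1`, `324L(d+2)²·(4|n|²(d+1)C_S M) ≤ 1`, `4ℓ·(4|n|²(d+1)C_S M) < δ_SU` (`ℓ = (d+2)L`). [cite: Balaban1985Averaging, Prop. 4 (134)–(135) p.38; Balaban1987RG1, (0.4)+(0.11) p.253] -/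
theorem norm_iter_cand_sub_one_sub_le (hL : P.d + 2 ≤ P.L) (A : PBond P k → Matrix n n ℂ) (hA : ∀ c, A c ∈ lieSU n) {M : ℝ} (hM : ∀ c, ‖A c‖ ≤ M) (hM1 : CS P * M ≤ 1)
    (hm : 324 * (P.L : ℝ) * ((P.d : ℝ) + 2) ^ 2 * (4 * (Fintype.card n : ℝ) ^ 2 * ((P.d : ℝ) + 1) * (CS P * M)) ≤ 1)
    (hN : 4 * (((P.d + 2) * P.L : ℕ) : ℝ) * (4 * (Fintype.card n : ℝ) ^ 2 * ((P.d : ℝ) + 1) * (CS P * M)) < deltaSU n) (c : PBond P k) :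
    ‖((Averaging.iter (fun i => blockAvg (P := P) (j := i) (expMeanLogSU (n := n))) k (cand k A hA) c : Matrix.specialUnitaryGroup n ℂ) : Matrix n n ℂ) - 1‖ ≤
        8 * (Fintype.card n : ℝ) ^ 2 * ((P.d : ℝ) + 1) * (CS P * M) ∧
    ‖((Averaging.iter (fun i => blockAvg (P := P) (j := i) (expMeanLogSU (n := n))) k (cand k A hA) c : Matrix.specialUnitaryGroup n ℂ) : Matrix n n ℂ) - 1 - A c‖ ≤
        (324 * (P.L : ℝ) * ((P.d : ℝ) + 2) ^ 2 * (4 * (Fintype.card n : ℝ) ^ 2 * ((P.d : ℝ) + 1) * CS P) ^ 2 + ((P.d : ℝ) + 1) * CS P ^ 2) * M ^ 2 := by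
  have hM0 : 0 ≤ M := (norm_nonneg _).trans (hM c)
  have hCS := CS_nonneg P
  have hLpos : (0 : ℝ) < P.L := by exact_mod_cast P.L_pos
  have hLk : (0 : ℝ) < (P.L : ℝ) ^ k := pow_pos hLpos k
  have hL1 : (1 : ℝ) ≤ (P.L : ℝ) ^ k := one_le_pow₀ (by exact_mod_cast P.hL.2.le)
  set U := cand k A hA with hU
  set a : PBond P 0 → Matrix n n ℂ := liftSM k A with ha
  set α : ℝ := CS P * M / (P.L : ℝ) ^ k with hα
  have hα0 : 0 ≤ α := by positivity
  -- (i): the candidate is `2α`-close to `1`, and `α²`-close to `1 + a`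
  have hbd := fun b => norm_coe_cand_sub_one_le k hk A hA hM hM1 b
  set δ : ℝ := 2 * α with hδ
  have hδ0 : 0 ≤ δ := by positivity
  have hUδ : ∀ b, ‖((U b : Matrix.specialUnitaryGroup n ℂ) : Matrix n n ℂ) - 1‖ ≤ δ := fun b => (hbd b).1
  -- R1's parameter at level k is k-free: (d+1)·L^k·δ = 2(d+1)·C_S·M
  have hscale : ((P.d : ℝ) + 1) * (P.L : ℝ) ^ k * δ = 2 * (((P.d : ℝ) + 1) * (CS P * M)) := by
    rw [hδ, hα]; field_simp
  have hm' : 324 * (P.L : ℝ) * ((P.d : ℝ) + 2) ^ 2 * (2 * (Fintype.card n : ℝ) ^ 2 * (((P.d : ℝ) + 1) * (P.L : ℝ) ^ k * δ)) ≤ 1 := by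
    rw [hscale]; convert hm using 1; ring
  have hN' : 4 * (((P.d + 2) * P.L : ℕ) : ℝ) * (2 * (Fintype.card n : ℝ) ^ 2 * (((P.d : ℝ) + 1) * (P.L : ℝ) ^ k * δ)) < deltaSU n := by
    rw [hscale]; convert hN using 1; ring
  -- R1 at s = k
  have R1 := norm_iter_sub_one_sub_iterLin_le_uniform (P := P) (n := n) linAvgIterM (fun Y => linAvgIterM_zero Y) (fun i Y c => linAvgIterM_succ i Y c) hL U hδ0 hUδ k hm' hN'
    k le_rfl c
  obtain ⟨R1a, R1b⟩ := R1
  have em : 2 * (Fintype.card n : ℝ) ^ 2 * (((P.d : ℝ) + 1) * (P.L : ℝ) ^ k * δ) = 4 * (Fintype.card n : ℝ) ^ 2 * ((P.d : ℝ) + 1) * (CS P * M) := by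
    rw [hscale]; ring
  rw [em] at R1a R1b
  refine ⟨by linarith [R1a], ?_⟩
  -- the linear term: `Q^{(k)}(U − 1) = Q^{(k)} a + Q^{(k)}(U − 1 − a) = A + Q^{(k)} r`
  set Y : PBond P 0 → Matrix n n ℂ := fun b => ((U b : Matrix.specialUnitaryGroup n ℂ) : Matrix n n ℂ) - 1 with hY
  set r : PBond P 0 → Matrix n n ℂ := fun b => Y b - a b with hr
  have hYsplit : Y = a + r := by funext b; simp only [hr, Pi.add_apply]; abel
  have hlin : linAvgIterM k Y c = A c + avgCLM P k r c := by
    rw [hYsplit, ← avgCLM_apply, map_add, Pi.add_apply, avgCLM_apply, ha, linAvgIterM_liftSM k hk]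
  -- size of `r` and of `Q^{(k)} r`
  have hrb : ∀ b, ‖r b‖ ≤ α ^ 2 := fun b => by
    simp only [hr, hY]
    exact (hbd b).2
  have hrpi : ‖r‖ ≤ α ^ 2 := (pi_norm_le_iff_of_nonneg (by positivity)).mpr hrb
  have hQr : ‖avgCLM P k r c‖ ≤ ((P.d : ℝ) + 1) * (P.L : ℝ) ^ k * α ^ 2 :=
    calc ‖avgCLM P k r c‖ ≤ ‖avgCLM P k r‖ := norm_le_pi_norm _ c
      _ ≤ ‖(avgCLM P k : (PBond P 0 → Matrix n n ℂ) →L[ℝ] (PBond P k → Matrix n n ℂ))‖ * ‖r‖ := ContinuousLinearMap.le_opNorm _ _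
      _ ≤ (((P.d : ℝ) + 1) * (P.L : ℝ) ^ k) * α ^ 2 := mul_le_mul (norm_avgCLM_le k) hrpi (norm_nonneg _) (by positivity)
  have hQr' : ((P.d : ℝ) + 1) * (P.L : ℝ) ^ k * α ^ 2 ≤ ((P.d : ℝ) + 1) * CS P ^ 2 * M ^ 2 := by
    rw [hα, div_pow]
    have e : ((P.d : ℝ) + 1) * (P.L : ℝ) ^ k * ((CS P * M) ^ 2 / ((P.L : ℝ) ^ k) ^ 2) = ((P.d : ℝ) + 1) * CS P ^ 2 * M ^ 2 / (P.L : ℝ) ^ k := by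
      field_simp
    rw [e]
    exact div_le_self (by positivity) hL1
  -- assemble
  have e2 : ((Averaging.iter (fun i => blockAvg (P := P) (j := i) (expMeanLogSU (n := n))) k U c : Matrix.specialUnitaryGroup n ℂ) : Matrix n n ℂ) - 1 - A c =
      (((Averaging.iter (fun i => blockAvg (P := P) (j := i) (expMeanLogSU (n := n))) k U c : Matrix.specialUnitaryGroup n ℂ) : Matrix n n ℂ) - 1 - linAvgIterM k Y c) +
        avgCLM P k r c := by
    rw [hlin]; abel
  rw [e2]
  calc ‖(((Averaging.iter (fun i => blockAvg (P := P) (j := i) (expMeanLogSU (n := n))) k U c : Matrix.specialUnitaryGroup n ℂ) : Matrix n n ℂ) - 1 - linAvgIterM k Y c) +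
          avgCLM P k r c‖
      ≤ ‖((Averaging.iter (fun i => blockAvg (P := P) (j := i) (expMeanLogSU (n := n))) k U c : Matrix.specialUnitaryGroup n ℂ) : Matrix n n ℂ) - 1 - linAvgIterM k Y c‖ +
          ‖avgCLM P k r c‖ := norm_add_le _ _
    _ ≤ 324 * (P.L : ℝ) * ((P.d : ℝ) + 2) ^ 2 * (4 * (Fintype.card n : ℝ) ^ 2 * ((P.d : ℝ) + 1) * (CS P * M)) ^ 2 + ((P.d : ℝ) + 1) * CS P ^ 2 * M ^ 2 :=
        add_le_add R1b (hQr.trans hQr')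
    _ = (324 * (P.L : ℝ) * ((P.d : ℝ) + 2) ^ 2 * (4 * (Fintype.card n : ℝ) ^ 2 * ((P.d : ℝ) + 1) * CS P) ^ 2 + ((P.d : ℝ) + 1) * CS P ^ 2) * M ^ 2 := by ring

/-! ## §4 Summary -/

include hk in
/-- **★★★ THE SMOOTH-LIFT CANDIDATE EXISTS**: for `𝔰𝔲(n)`-valued coarse data `A` with `‖A‖ ≤ M` small (`k`-free smallness rows), there is a finest `SU(n)` field whose bond variables are
within `2C_S M/L^k` of `1`, whose finest plaquettes are ALL within `(4·18^d·M + 16(C_S M)²)/(L^k)²` of `1`, and whose `k`-fold (0.4) averages are `1 + A + O(M²)` bond by bond with a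
`k`-free constant — the per-stencil START of the (FL) contraction. [cite: Balaban1985Variational, Thm 1 (8) p.279; Balaban1985Averaging, Prop. 4 (134)–(135) p.38] -/
theorem exists_smoothLiftCandidate (hL : P.d + 2 ≤ P.L) (A : PBond P k → Matrix n n ℂ) (hA : ∀ c, A c ∈ lieSU n) {M : ℝ} (hM : ∀ c, ‖A c‖ ≤ M) (hM4 : 4 * (CS P * M) ≤ 1)
    (hm : 324 * (P.L : ℝ) * ((P.d : ℝ) + 2) ^ 2 * (4 * (Fintype.card n : ℝ) ^ 2 * ((P.d : ℝ) + 1) * (CS P * M)) ≤ 1)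
    (hN : 4 * (((P.d + 2) * P.L : ℕ) : ℝ) * (4 * (Fintype.card n : ℝ) ^ 2 * ((P.d : ℝ) + 1) * (CS P * M)) < deltaSU n) :
    ∃ U : GaugeField P 0 (Matrix.specialUnitaryGroup n ℂ),
      (∀ b, ‖((U b : Matrix.specialUnitaryGroup n ℂ) : Matrix n n ℂ) - 1‖ ≤ 2 * (CS P * M / (P.L : ℝ) ^ k)) ∧
      (∀ q : Plaq P 0, GaugeGroup.dist1 (GaugeField.plaqHol U q) ≤ 4 * (18 : ℝ) ^ P.d * M / ((P.L : ℝ) ^ k) ^ 2 + 16 * (CS P * M / (P.L : ℝ) ^ k) ^ 2) ∧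
      ∀ c : PBond P k,
        ‖((Averaging.iter (fun i => blockAvg (P := P) (j := i) (expMeanLogSU (n := n))) k U c : Matrix.specialUnitaryGroup n ℂ) : Matrix n n ℂ) - 1 - A c‖ ≤
          (324 * (P.L : ℝ) * ((P.d : ℝ) + 2) ^ 2 * (4 * (Fintype.card n : ℝ) ^ 2 * ((P.d : ℝ) + 1) * CS P) ^ 2 + ((P.d : ℝ) + 1) * CS P ^ 2) * M ^ 2 := by
  have hM1 : CS P * M ≤ 1 := by
    have : 0 ≤ CS P * M := by
      have hM0 : 0 ≤ M := (norm_nonneg _).trans (hM ⟨fun _ => 0, ⟨0, P.hd⟩⟩)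
      exact mul_nonneg (CS_nonneg P) hM0
    linarith
  exact ⟨cand k A hA, fun b => (norm_coe_cand_sub_one_le k hk A hA hM hM1 b).1, fun q => dist1_plaqHol_cand_le k hk A hA hM hM4 q,
    fun c => (norm_iter_cand_sub_one_sub_le k hk hL A hA hM hM1 hm hN c).2⟩

end Summit.QuantumFields.YangMills.Theorems.SmoothLiftCandidate

end
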